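import Literature.MathematicalPhysics.QuantumFieldTheory.Balaban1983to89.B3Ineq210ZeroBox
import Literature.MathematicalPhysics.QuantumFieldTheory.Balaban1983to89.B4Lemma22HolderBox

/-!
# `Balaban1983to89.B3Eq26ConstBox` — T. Bałaban, *(Higgs)₂,₃ quantum fields in a finite volume. III. Renormalization*,
# Commun. Math. Phys. **88** (1983) 411–445 [Balaban1983Higgs3]: the scale decomposition (2.6) p. 424 of the propagator
# `G_k(Ω,B̃) = Σ_{j=0}^{k−1} G^η_{(j)}(Ω,B̃)` for the MODEL INSTANCE `Ω = □`, `B̃ = B̃₀` a NON-ZERO CONSTANT background field,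
# `N`-component fields, together with the p. 433 gauge step «the gauge transformation which removes the field B̃₀ … We get the
# same expressions as above with B̃₀ = 0 only» PROVED for the covariant scale operators and the pieces: they are the gauge
# conjugates of the zero-field ones, their `N × N` blocks are the zero-field kernels times orthogonal transporters

statement-level skeleton of published theorems with citation tags; proofs where landed; nothing here is a claim about the Yang–Mills mass gap

PDF held: `paper:balaban1983-higgs-2-3-quantum-fields-finite-volume` (journal page = PDF page + 410); p. 424 [PDF 14] ((2.6)),
p. 426 [PDF 16] ((2.10)–(2.11)), p. 433 [PDF 23] (the reduction steps: cubes `□₁ ⊂ □`, `B̃ = B̃₀ + B̃′`, the gauge transformation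
removing `B̃₀`) read in the OCR text (`p0014.txt`, `p0016.txt`, `p0023.txt`); [B4] = T. Bałaban, *Regularity and decay of lattice
Green's functions*, CMP **89** (1983) [Balaban1983RegularityDecay], (1.2)–(1.6) p. 572 and p. 581 «Lemma 2.2 in the case of a
constant configuration A₀ is equivalent to the case of configuration A₀ = 0 by the same argument with the gauge transformation»,
as quoted by `B4GaugeCovariance`.

CITATION HEADER (lean-in-tree rule).  Part of the lit-balaban TYPED SKELETON (HOME `run/shared/lean/pub/lit-balaban/`), Phase 2,
proof seat **p03 gen 7** (unit `lit-balaban-p03-g7`), file 1 of 2 (file 2 `B3Ineq210ConstBox`: the carrier and (2.10)/(2.11)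
discharged); SKELETON rows **B3.Eq2.6** (decl of record p251304, owner r15 `HOME/lit-balaban-r15/ROWS-B3.md`), **B3.Eq2.10**
(inputs) and the located gauge sentence of **B3.Txt@433**.  CONSTANT-BACKGROUND TWIN of this seat's zero-field box file
`B3Ineq210ZeroBox` (gen 4, p253409: pieces `piece`, (2.6) `sum_piece`), USED BY NAME; built on the [B4] gauge dictionary of
cell `b2b-balaban-b04` (`B4GaugeCovariance`: `b4Green`, `b4Green_constBond`, `fieldLink_constBond`, `scalarOp`, `boxWt`/`blkWt`,
`pathEnd_direct`, `abs_apply_le_one_of_orthogonal`), the lineage's covariant derivative `B4Lemma21Region.covDeriv` ([B4] (1.3)) and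
`B4Lemma22HolderBox.transport_constBond`; nothing of these is re-proved, no existing module is touched.

WHAT IS PRINTED.  (2.6) p. 424: *"Our first step in the proof of the theorem is to write the expression … as a sum obtained by
decomposing all the propagators corresponding to the lines of G′ according to the equality G_k(Ω,B̃) = Σ_{j=0}^{k−1} G^η_{(j)}(Ω,B̃)
(2.6) and the similar equality for the vector field propagator."*  p. 433: *"Hence there exists a constant field B̃₀ such that
|B̃ − B̃₀| ≤ O(r(L^kε)p(L^kε)) … on the cube □. We have B̃ = B̃₀ + B̃′ … A scalar field propagator is G_k(□,B̃₀). It is easy to see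
that the expression corresponding to any such renormalized class is gauge-invariant with respect to gauge transformations of
the field B̃₀, if the external scalar fields are simultaneously transformed. Our next operation is the gauge transformation
which removes the field B̃₀. It was described more precisely in the proof of Lemma II.2.4. We get the same expressions as above
with B̃₀ = 0 only (and external scalar fields gauge transformed)."*

WHAT IS REPRODUCED (kind «model-instance», G.1 of `HOME/PHASE2-TARGETS.md`).  On the fine box `□ ∩ ηℤ^{d+1}` (`η = L^{−k}`,
`L = ℓ + 1`, `L^kM_i` sites a side, Neumann bond weights; the lattice of the gen-4 zero-field instances) with `N`-component fields
`ℝ^N = ι → ℝ`, [B4]'s abelian one-parameter orthogonal link group `U(t) = e^{tq}` (`OrthFlow`; the U(1) Higgs field of [B3] is the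
`N = 2` rotation flow `OrthFlow.rot`), charge parameter `κ = eη`, and a CONSTANT vector field `B̃₀ ∈ ℝ^{d+1}` (`constBond B̃₀`:
`B̃₀(u,v) = ⟨B̃₀, v − u⟩`):
* §1 the dictionary `scalarOp (boxWt n) m² α′ (blkWt b_j) = opBoxR n² m² α′ b_j` AT EVERY AVERAGING SCALE `j ≤ k` (`scalarOp_opBoxR`,
  `scalarOp_fineOp`; the one-scale case is b04's `scalarOp_box`);
* §2 **the covariant scale operators `G_j^η(□,B̃₀)`** (`GfineA0`) = [B4]'s (1.6) `(−Δ^{η,N}_{B̃₀,□} + m² + α_jP_j(B̃₀))^{−1}` with the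
  COVARIANT averaging (1.4) over `L^j`-blocks (contour transports from the block corners, `cornerEmb`), and the p. 433 sentence
  for them: `G_j^η(□,B̃₀) = 𝒢(G_j^η(□,0) ⊗ 1_N)𝒢ᵀ` (`GfineA0_eq`; gauge `𝒢 = ⊕_xU(κλ(x))`, `λ = −⟨B̃₀,x⟩`, `gA0`; zero-field operators
  `B4Thm110ZeroBox.Gfine`), INDEPENDENCE of the contour system (`GfineA0_contour_indep`), the top operator = the [B4] lineage's
  `G_k(□,A₀)` (`GfineA0_top`), entries (`GfineA0_apply`);
* §3 **(2.6) at `B̃₀`**: the pieces `G^η_{(0)} = G^η_1`, `G^η_{(j)} = G^η_{j+1} − G^η_j` (`pieceA0`) sum to `G_k(□,B̃₀)` (`sum_pieceA0`)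
  and are the gauge conjugates of the zero-field pieces (`pieceA0_eq`, `blk2_pieceA0`, `pieceA0_apply`; entrywise domination
  `abs_pieceA0_le`);
* §4 the transporter `U(B̃₀(Γ_{x₁,x₂})) = g(x₁)g(x₂)ᵀ` along EVERY contour (`Ub`, `Ub_eq_pair`, `transport_eq_Ub`, `Ub_orth`), the
  covariant difference `η·D^η_{B̃₀,μ}` of a kernel in the row variable (`covDiff` = the lineage's `covDeriv` acting on columns:
  `blk2_covDeriv_mul_of_mem`/`_of_not_mem`) and the two cancellation identities behind (2.10)/(2.11) at `B̃₀`: `covDiff_conj`,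
  `holderBlock_conj` (the transporter compensates the gauge factors exactly).

HONEST SCOPE / DECLARED DIVERGENCES (F7).  (i) `Ω = □` a box of unit blocks with Neumann conditions and `B̃ = B̃₀` CONSTANT: the
print's general small `B̃` requires the expansion in `B̃′` of p. 433 / [B4] (2.23)–(2.33), NOT formalised here.  (ii) The
structure group is [B4]'s abelian one-parameter orthogonal flow (commuting link variables); a constant field is then a pure
gauge ON THE BOX (`B4GaugeCovariance.constBond_eq_bondGauge`) — not on the torus `T_η` (holonomy), and nothing is claimed there;
this matches p. 433, where the gauge transformation acts on the cube `□ ⊂ T_η` after `G_k(Ω,B̃) = G_k(□,B̃) + δG_k`.  (iii) The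
graph-level sentence «the expression corresponding to any such renormalized class is gauge-invariant» is certified here only
for its propagator ingredient (scale operators, pieces, covariant derivatives, transporters); the external-field norm
ingredient (p. 434) is the companion `B3Norm132ConstGauge`.  (iv) ROUTE = the print's (gauge step p. 433 = [B4] p. 581), as
operator identities; no Literature fact is minted (all `def`s have bodies, all theorems proved); standard axioms.  Value =
kernel certificate of a located by-reference step of [B3] at a non-zero constant background; NOT summit progress.
Unit `lit-balaban-p03-g7` (Phase-2 proof seat p03, gen 7); HOME `run/shared/lean/pub/lit-balaban/` (rows B3.Eq2.6/2.10,
B3.Txt@433; FILED.md, STATUS.md).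
-/

namespace Literature.MathematicalPhysics.QuantumFieldTheory.Balaban1983to89.B3Eq26ConstBox

open Matrix Finset
open scoped Kronecker
open B4GaugeCovariance
open B4Reflection242 (boxDom blk mem_boxDom blk_mem_boxDom nbrs not_mem_nbrs_self nbrs_comm neumannLapK diagK avgK)
open B4BoxCov237 (opBoxR opBoxR_isUnit)
open B4ContourShift (supNorm)
open B4Thm110ZeroBox (Nf bj sc fineOp Gfine αj bj_pos bj_cast sc_pos one_lt_L_real Nf_pos)
open B4Lemma22HolderBox (transport_constBond)
open B3Ineq210ZeroBox (piece piece_zero piece_of_pos piece_of_le sum_piece)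

noncomputable section

variable {d : ℕ} {ι : Type} [Fintype ι] [DecidableEq ι]

/-! ## §1 Geometry of the scales on the fine box, and the dictionary `scalarOp = opBoxR` at every averaging scale -/

/-- the number of `b_j = L^j`-blocks per side of the fine box `Π_i[0, L^kM_i)` at averaging scale `j ≤ k`:
`L^{k−j}M_i`. [cite: Balaban1983Higgs3, (2.6) p.424] -/
abbrev Mb (ℓ k : ℕ) (M : Fin (d + 1) → ℕ) (j : ℕ) : Fin (d + 1) → ℕ := fun i => (ℓ + 1) ^ (k - j) * M i

omit [Fintype ι] [DecidableEq ι] in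
/-- kernel: `b_j · (L^{k−j}M) = L^kM` (`j ≤ k`). [folklore] -/
private theorem bj_mul_Mb {ℓ k j : ℕ} (hj : j ≤ k) (M : Fin (d + 1) → ℕ) :
    (fun i => bj ℓ j * Mb ℓ k M j i) = Nf ℓ k M := by
  funext i
  simp only [bj, Mb, Nf]
  rw [← mul_assoc, ← pow_add, Nat.add_sub_cancel' hj]

omit [Fintype ι] [DecidableEq ι] in
/-- kernel: the `b_j`-block label of a fine point is a block of the scale-`j` box. [folklore] -/
private theorem blk_mem_Mb {ℓ k j : ℕ} (hj : j ≤ k) {M : Fin (d + 1) → ℕ} (x : ↥(boxDom (Nf ℓ k M))) :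
    blk (bj ℓ j) x.1 ∈ boxDom (Mb ℓ k M j) := by
  have hx : x.1 ∈ boxDom (fun i => bj ℓ j * Mb ℓ k M j i) := by rw [bj_mul_Mb hj]; exact x.2
  exact blk_mem_boxDom (bj_pos ℓ j) hx

omit [Fintype ι] [DecidableEq ι] in
/-- kernel: DICTIONARY — the scalar part of [B4]'s operator (1.6) with bond weights `n²/2` per oriented bond, block weights
`1[blk_b x = y]` and averaging coefficient `a′` IS the lineage's `opBoxR n² m² a′ b N`, whenever the `b`-blocks of the box are
labelled by `Mb′` (the one-scale case `b = n` is `B4GaugeCovariance.scalarOp_box`) — DICTIONARY between [B4]'s printed operator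
(1.3)–(1.6) and the lineage's box operator. [cite: Balaban1983RegularityDecay, (1.6) p.572] -/
theorem scalarOp_opBoxR {n b : ℕ} {N Mb' : Fin (d + 1) → ℕ} (hblk : ∀ z : ↥(boxDom N), blk b z.1 ∈ boxDom Mb')
    (a' m2 : ℝ) :
    scalarOp (boxWt n N) m2 a' (blkWt b Mb' N) = opBoxR ((n : ℝ) ^ 2) m2 a' b N := by
  ext z z'
  rw [scalarOp, Matrix.of_apply, sum_boxWt_left, sum_boxWt_right, sum_blkWt (hblk z)]
  simp only [opBoxR, Matrix.of_apply, neumannLapK, diagK, avgK, boxWt]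
  by_cases h : z = z'
  · subst h
    simp [not_mem_nbrs_self]
    ring
  · have h1 : z'.1 ≠ z.1 := fun e => h (Subtype.ext e).symm
    have hc : (z.1 ∈ nbrs z'.1) = (z'.1 ∈ nbrs z.1) := propext nbrs_comm
    simp only [h, h1, if_false, hc, zero_sub, sub_zero, zero_add]
    split_ifs <;> ring

omit [Fintype ι] [DecidableEq ι] in
/-- kernel: at averaging scale `j ≤ k` the scalar part of [B4]'s (1.6) on the fine box with coefficient `α_j b_j^{−(d+1)}` is the
lineage's scale-`j` fine operator `fineOp` (`G_j^η(□)^{-1}` in values form) — DICTIONARY, [B4] (1.6) at `A = 0` («G_k(□,0) =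
G_k(□)1», p. 582). [cite: Balaban1983RegularityDecay, (1.6) p.572] -/
theorem scalarOp_fineOp {ℓ k j : ℕ} (hj : j ≤ k) (M : Fin (d + 1) → ℕ) (a m2 : ℝ) :
    scalarOp (boxWt ((ℓ + 1) ^ k) (Nf ℓ k M)) m2 (αj a ℓ k j * (((bj ℓ j : ℝ)) ^ (d + 1))⁻¹)
        (blkWt (bj ℓ j) (Mb ℓ k M j) (Nf ℓ k M))
      = fineOp ℓ k M j a m2 := by
  rw [scalarOp_opBoxR (blk_mem_Mb hj), fineOp]

omit [Fintype ι] [DecidableEq ι] in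
/-- kernel: the scale-`j` fine operator is invertible on the window (`1 ≤ j`, `a > 0`, `m² ≥ 0`, `M_i ≥ 1`). [folklore] -/
private theorem fineOp_isUnit' {ℓ k j : ℕ} (hℓ : 1 ≤ ℓ) (hj1 : 1 ≤ j) {M : Fin (d + 1) → ℕ} (hM : ∀ i, 1 ≤ M i) {a m2 : ℝ}
    (ha : 0 < a) (hm : 0 ≤ m2) : IsUnit (fineOp ℓ k M j a m2) := by
  unfold fineOp
  refine opBoxR_isUnit (by positivity) hm ?_ (bj ℓ j) (Nf_pos hM)
  exact mul_pos (mul_pos (B1.aSeq_pos ha (one_lt_L_real hℓ) hj1) (pow_pos (sc_pos ℓ k j) 2))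
    (inv_pos.2 (by positivity))

/-! ## §2 The canonical contour system and the covariant scale operators `G_j^η(□, B̃₀)` -/

omit [Fintype ι] [DecidableEq ι] in
/-- kernel: the base corner `b_j·y` of the block with label `y` is a fine point of the box (`j ≤ k`). [folklore] -/
private theorem corner_mem {ℓ k j : ℕ} (hj : j ≤ k) {M : Fin (d + 1) → ℕ} (y : ↥(boxDom (Mb ℓ k M j))) :
    (fun i => (bj ℓ j : ℤ) * y.1 i) ∈ boxDom (Nf ℓ k M) := by
  rw [mem_boxDom]
  intro i
  have hy := (mem_boxDom.1 y.2) i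
  have hb : (0 : ℤ) < (bj ℓ j : ℤ) := by exact_mod_cast bj_pos ℓ j
  have hN : ((Nf ℓ k M i : ℕ) : ℤ) = (bj ℓ j : ℤ) * (Mb ℓ k M j i : ℤ) := by
    obtain ⟨t, rfl⟩ := Nat.exists_eq_add_of_le hj
    simp only [Nf, Mb, bj, Nat.add_sub_cancel_left, pow_add]
    push_cast
    ring
  refine ⟨mul_nonneg hb.le hy.1, ?_⟩
  rw [hN]
  exact mul_lt_mul_of_pos_left hy.2 hb

/-- the CANONICAL base points of the averaging contours: the corner `b_j·y` of the block `B^j(y)` ([B4] p. 572 takes for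
`Γ^{(j)}_{y,x}` a contour in `B^j(y)` from its base point to `x`; for a constant background the choice is immaterial,
`GfineA0_contour_indep`). [cite: Balaban1983RegularityDecay, p. 572 (1.4)] -/
def cornerEmb {ℓ k j : ℕ} (hj : j ≤ k) (M : Fin (d + 1) → ℕ) :
    ↥(boxDom (Mb ℓ k M j)) → ↥(boxDom (Nf ℓ k M)) :=
  fun y => ⟨_, corner_mem hj y⟩

variable (F : OrthFlow ι) (κ : ℝ) (A₀ : Fin (d + 1) → ℝ)

/-- the GAUGE `g(x) = U(κλ(x))`, `λ = −⟨B̃₀, x⟩`, which removes the constant field `B̃₀` on the fine box ([B3] p. 433: «Our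
next operation is the gauge transformation which removes the field B̃₀. It was described more precisely in the proof of Lemma
II.2.4»; [B4] p. 581; `B4GaugeCovariance.linGauge`). [cite: Balaban1983Higgs3, p.433] -/
def gA0 (ℓ k : ℕ) (M : Fin (d + 1) → ℕ) : ↥(boxDom (Nf ℓ k M)) → Matrix ι ι ℝ :=
  fun x => F.U (κ * linGauge A₀ Subtype.val x)

/-- the gauge is orthogonal sitewise. [cite: Balaban1983Higgs3, p.433] -/
theorem isGauge_gA0 (ℓ k : ℕ) (M : Fin (d + 1) → ℕ) : IsGauge (gA0 F κ A₀ ℓ k M) :=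
  F.isGauge _

/-- the transporter `g(x)g(x′)ᵀ = U(B̃₀(Γ_{x,x′}))` between two fine points is orthogonal. [cite: Balaban1983Higgs3, (1.32) p.420] -/
theorem gA0_pair_orth (ℓ k : ℕ) (M : Fin (d + 1) → ℕ) (x x' : ↥(boxDom (Nf ℓ k M))) :
    (gA0 F κ A₀ ℓ k M x * (gA0 F κ A₀ ℓ k M x')ᵀ)ᵀ * (gA0 F κ A₀ ℓ k M x * (gA0 F κ A₀ ℓ k M x')ᵀ) = 1 := by
  rw [Matrix.transpose_mul, Matrix.transpose_transpose, Matrix.mul_assoc,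
    ← Matrix.mul_assoc (gA0 F κ A₀ ℓ k M x)ᵀ (gA0 F κ A₀ ℓ k M x), isGauge_gA0 F κ A₀ ℓ k M x, Matrix.one_mul,
    (isGauge_gA0 F κ A₀ ℓ k M).mul_transpose]

/-- **The covariant scale operators `G_j^η(□, B̃₀)`, `1 ≤ j ≤ k`, of the decomposition (2.6) at a CONSTANT background `B̃₀`**:
[B4]'s Green's function (1.6) `(−Δ^{η,N}_{B̃₀,□} + m² + α_jP_j(B̃₀))^{−1}` on the fine box `□ ∩ ηℤ^{d+1}` (`η = L^{−k}`, `L^kM_i`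
sites a side, Neumann bond weights `η^{−2} = n²`), with the COVARIANT block averaging `Q_j(B̃₀)` of (1.4) over `b_j = L^j`-blocks
(parallel transport `U(B̃₀(Γ^{(j)}_{y,x}))` along the canonical contours from the block corners) and the running coefficient
`α_j = a_j(L^jη)^{−2}` carried as `α_jb_j^{−(d+1)}` exactly as in the zero-field lineage (`B4Thm110ZeroBox.fineOp`); link variables
`U(B̃₀,b) = e^{qeηB̃₀(b)}` = `fieldLink F κ (constBond B̃₀)` for the one-parameter orthogonal flow `F` ([B4] (1.2)), `κ = eη`.
Junk value `0` for `j > k` (no such scale occurs in (2.6)). [cite: Balaban1983Higgs3, (2.6) p.424] -/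
def GfineA0 (ℓ k : ℕ) (M : Fin (d + 1) → ℕ) (j : ℕ) (a m2 : ℝ) :
    Matrix (↥(boxDom (Nf ℓ k M)) × ι) (↥(boxDom (Nf ℓ k M)) × ι) ℝ :=
  if hj : j ≤ k then
    b4Green F κ (boxWt ((ℓ + 1) ^ k) (Nf ℓ k M)) m2 (αj a ℓ k j * (((bj ℓ j : ℝ)) ^ (d + 1))⁻¹)
      (blkWt (bj ℓ j) (Mb ℓ k M j) (Nf ℓ k M)) (cornerEmb hj M) (fun _ x => [x]) (constBond A₀ Subtype.val)
  else 0

variable {F κ A₀}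

section Scale

variable {ℓ k j : ℕ} {M : Fin (d + 1) → ℕ} {a m2 : ℝ}

omit [Fintype ι] [DecidableEq ι] in
/-- kernel: on the window the scalar operator behind `G_j^η(□,B̃₀)` has invertible determinant. [folklore] -/
private theorem scalarOp_det_isUnit (hℓ : 1 ≤ ℓ) (hj1 : 1 ≤ j) (hjk : j ≤ k) (hM : ∀ i, 1 ≤ M i) (ha : 0 < a) (hm : 0 ≤ m2) :
    IsUnit (scalarOp (boxWt ((ℓ + 1) ^ k) (Nf ℓ k M)) m2 (αj a ℓ k j * (((bj ℓ j : ℝ)) ^ (d + 1))⁻¹)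
      (blkWt (bj ℓ j) (Mb ℓ k M j) (Nf ℓ k M))).det := by
  rw [scalarOp_fineOp hjk]
  exact (Matrix.isUnit_iff_isUnit_det _).1 (fineOp_isUnit' hℓ hj1 hM ha hm)

/-- **«We get the same expressions as above with B̃₀ = 0 only» (p. 433) AT THE LEVEL OF THE SCALE OPERATORS**: for `1 ≤ j ≤ k`
on the window, `G_j^η(□, B̃₀) = 𝒢 (G_j^η(□, 0) ⊗ 1_N) 𝒢ᵀ` with the gauge `𝒢 = ⊕_x U(κλ(x))` and the zero-field (one-component)
scale operator `G_j^η(□,0) = B4Thm110ZeroBox.Gfine` of the lineage — [B4] p. 581 «equivalent to the case of configuration A₀ = 0 by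
… the gauge transformation», `B4GaugeCovariance.b4Green_constBond`. [cite: Balaban1983Higgs3, p.433] -/
theorem GfineA0_eq (hℓ : 1 ≤ ℓ) (hj1 : 1 ≤ j) (hjk : j ≤ k) (hM : ∀ i, 1 ≤ M i) (ha : 0 < a) (hm : 0 ≤ m2) :
    GfineA0 F κ A₀ ℓ k M j a m2
      = blockDiag (gA0 F κ A₀ ℓ k M) * (Gfine ℓ k M j a m2 ⊗ₖ (1 : Matrix ι ι ℝ)) * (blockDiag (gA0 F κ A₀ ℓ k M))ᵀ := by
  rw [GfineA0, dif_pos hjk, b4Green_constBond F κ _ m2 _ (pathEnd_direct _ _) A₀ _ (scalarOp_det_isUnit hℓ hj1 hjk hM ha hm),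
    scalarOp_fineOp hjk]
  rfl

/-- **INDEPENDENCE OF THE CONTOUR SYSTEM**: for the constant background every admissible system of averaging contours (base points
`emb`, contours `Γ^{(j)}_{y,x}` ending at `x`) gives the SAME operator `G_j^η(□,B̃₀)` — the transporter of a zero-curvature
configuration along any contour from `u` to `v` is `g(u)g(v)ᵀ` (`B4Lemma22HolderBox.transport_constBond`), and base-point changes are
left gauge factors on the block lattice, invisible in `P_j = Q_j^*Q_j`. [cite: Balaban1983Higgs3, (2.6) p.424] -/
theorem GfineA0_contour_indep (hℓ : 1 ≤ ℓ) (hj1 : 1 ≤ j) (hjk : j ≤ k) (hM : ∀ i, 1 ≤ M i) (ha : 0 < a) (hm : 0 ≤ m2)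
    (emb : ↥(boxDom (Mb ℓ k M j)) → ↥(boxDom (Nf ℓ k M)))
    (Γ : ↥(boxDom (Mb ℓ k M j)) → ↥(boxDom (Nf ℓ k M)) → List ↥(boxDom (Nf ℓ k M)))
    (hend : ∀ y x, blkWt (bj ℓ j) (Mb ℓ k M j) (Nf ℓ k M) y x ≠ 0 → pathEnd (emb y) (Γ y x) = x) :
    b4Green F κ (boxWt ((ℓ + 1) ^ k) (Nf ℓ k M)) m2 (αj a ℓ k j * (((bj ℓ j : ℝ)) ^ (d + 1))⁻¹)
        (blkWt (bj ℓ j) (Mb ℓ k M j) (Nf ℓ k M)) emb Γ (constBond A₀ Subtype.val)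
      = GfineA0 F κ A₀ ℓ k M j a m2 := by
  rw [GfineA0_eq hℓ hj1 hjk hM ha hm, b4Green_constBond F κ _ m2 _ hend A₀ _ (scalarOp_det_isUnit hℓ hj1 hjk hM ha hm),
    scalarOp_fineOp hjk]
  rfl

/-- **the top scale operator is [B4]'s propagator (1.6) `G_k(□, B̃₀) = (−Δ^{η,N}_{B̃₀,□} + m² + a_kP_k(B̃₀))^{−1}`** with the running
coefficient `a_k(L^kη)^{−2}·η^{d+1}… = a_k·n^{−(d+1)}` in the lineage's values form and `L^k`-blocks — literally the operator
`B4Lemma22ReduceZero.greenA0` of the [B4] lineage (same bond weights, coefficient, link variables; block labels `Mb k = L⁰·M` and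
the canonical contours here). [cite: Balaban1983Higgs3, (2.6) p.424] -/
theorem GfineA0_top :
    GfineA0 F κ A₀ ℓ k M k a m2
      = b4Green F κ (boxWt ((ℓ + 1) ^ k) (Nf ℓ k M)) m2
          (B1.aSeq a ((ℓ : ℝ) + 1) k * (((((ℓ + 1) ^ k : ℕ)) : ℝ) ^ (d + 1))⁻¹)
          (blkWt ((ℓ + 1) ^ k) (Mb ℓ k M k) (Nf ℓ k M)) (cornerEmb le_rfl M) (fun _ x => [x])
          (constBond A₀ Subtype.val) := by
  rw [GfineA0, dif_pos le_rfl, αj, B4Thm110ZeroBox.sc_self, one_pow, mul_one]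

end Scale

/-! ## §3 Block entries of gauge conjugates; the pieces `G^η_{(j)}(□, B̃₀)` of (2.6) and the identity (2.6) itself -/

section Blocks

variable {X : Type*} [Fintype X] [DecidableEq X]

/-- the `N × N` block `K(x, x′)` of an operator on `ℝ^N`-valued fields (the kernel value «G(x, x′)» of the print, an operator on
`ℝ^N`). [cite: Balaban1983Higgs3, (2.10) p.426] -/
def blk2 (K : Matrix (X × ι) (X × ι) ℝ) (x x' : X) : Matrix ι ι ℝ := Matrix.of fun i i' => K (x, i) (x', i')

omit [Fintype X] [DecidableEq X] [Fintype ι] [DecidableEq ι] in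
/-- entries of a block. [cite: Balaban1983Higgs3, (2.10) p.426] -/
@[simp] theorem blk2_apply (K : Matrix (X × ι) (X × ι) ℝ) (x x' : X) (i i' : ι) : blk2 K x x' i i' = K (x, i) (x', i') := rfl

omit [Fintype X] [DecidableEq X] [Fintype ι] [DecidableEq ι] in
/-- blocks of a difference. [cite: Balaban1983Higgs3, (2.6) p.424] -/
theorem blk2_sub (K K' : Matrix (X × ι) (X × ι) ℝ) (x x' : X) : blk2 (K - K') x x' = blk2 K x x' - blk2 K' x x' := by
  ext i i'; rfl

/-- kernel: **the blocks of a gauge conjugate of a one-component operator**: `(𝒢 (S ⊗ 1) 𝒢ᵀ)(x,x′) = S(x,x′)·g(x)g(x′)ᵀ`. [folklore] -/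
private theorem blk2_conj (g : X → Matrix ι ι ℝ) (S : Matrix X X ℝ) (x x' : X) :
    blk2 (blockDiag g * (S ⊗ₖ (1 : Matrix ι ι ℝ)) * (blockDiag g)ᵀ) x x' = S x x' • (g x * (g x')ᵀ) := by
  ext i i'
  rw [blk2_apply, ← blockOp_smul_one, ← blockOp_gaugeKer, blockOp_apply, gaugeKer_apply, Matrix.mul_smul, Matrix.mul_one,
    Matrix.smul_mul]

omit [Fintype X] [DecidableEq X] in
/-- kernel: a product of two sitewise-orthogonal factors `g(x)g(x′)ᵀ` is orthogonal. [folklore] -/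
private theorem orth_pair {g : X → Matrix ι ι ℝ} (hg : IsGauge g) (x x' : X) :
    (g x * (g x')ᵀ)ᵀ * (g x * (g x')ᵀ) = 1 := by
  rw [Matrix.transpose_mul, Matrix.transpose_transpose, Matrix.mul_assoc, ← Matrix.mul_assoc (g x)ᵀ (g x), hg x,
    Matrix.one_mul, hg.mul_transpose]

omit [Fintype X] [DecidableEq X] in
/-- kernel: `g(x)g(y)ᵀ · g(y)g(z)ᵀ = g(x)g(z)ᵀ` (the cocycle of pure-gauge transporters). [folklore] -/
private theorem pair_mul_pair {g : X → Matrix ι ι ℝ} (hg : IsGauge g) (x y z : X) :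
    g x * (g y)ᵀ * (g y * (g z)ᵀ) = g x * (g z)ᵀ := by
  rw [Matrix.mul_assoc, ← Matrix.mul_assoc (g y)ᵀ (g y), hg y, Matrix.one_mul]

omit [Fintype X] [DecidableEq X] [Fintype ι] in
/-- kernel: `(S − S′) ⊗ 1 = S ⊗ 1 − S′ ⊗ 1`. [folklore] -/
private theorem sub_kronecker_one (S S' : Matrix X X ℝ) :
    (S - S') ⊗ₖ (1 : Matrix ι ι ℝ) = S ⊗ₖ (1 : Matrix ι ι ℝ) - S' ⊗ₖ (1 : Matrix ι ι ℝ) := by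
  ext ⟨x, i⟩ ⟨x', i'⟩
  simp [Matrix.kroneckerMap_apply, sub_mul]

end Blocks

section Pieces

variable {ℓ k j : ℕ} {M : Fin (d + 1) → ℕ} {a m2 : ℝ}

/-- **The blocks of the scale operators**: `G_j^η(□,B̃₀)(x,x′) = G_j^η(□,0)(x,x′)·U(κ(λ(x) − λ(x′)))` — the zero-field kernel times
the ORTHOGONAL transporter `g(x)g(x′)ᵀ = U(B̃₀(Γ_{x,x′}))` ([B4] p. 590: «with φ(x), φ(x′) replaced by φ(x), U(A₀(⟨x,x′⟩))φ(x′)»).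
[cite: Balaban1983Higgs3, p.433] -/
theorem blk2_GfineA0 (hℓ : 1 ≤ ℓ) (hj1 : 1 ≤ j) (hjk : j ≤ k) (hM : ∀ i, 1 ≤ M i) (ha : 0 < a) (hm : 0 ≤ m2)
    (x x' : ↥(boxDom (Nf ℓ k M))) :
    blk2 (GfineA0 F κ A₀ ℓ k M j a m2) x x' = Gfine ℓ k M j a m2 x x' • (gA0 F κ A₀ ℓ k M x * (gA0 F κ A₀ ℓ k M x')ᵀ) := by
  rw [GfineA0_eq hℓ hj1 hjk hM ha hm, blk2_conj]

/-- the same, entrywise: `G_j^η(□,B̃₀)((x,i),(x′,i′)) = G_j^η(□,0)(x,x′)·(g(x)g(x′)ᵀ)_{ii′}`. [cite: Balaban1983Higgs3, p.433] -/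
theorem GfineA0_apply (hℓ : 1 ≤ ℓ) (hj1 : 1 ≤ j) (hjk : j ≤ k) (hM : ∀ i, 1 ≤ M i) (ha : 0 < a) (hm : 0 ≤ m2)
    (x x' : ↥(boxDom (Nf ℓ k M))) (i i' : ι) :
    GfineA0 F κ A₀ ℓ k M j a m2 (x, i) (x', i')
      = Gfine ℓ k M j a m2 x x' * (gA0 F κ A₀ ℓ k M x * (gA0 F κ A₀ ℓ k M x')ᵀ) i i' := by
  have h := congrFun (congrFun (blk2_GfineA0 (F := F) (κ := κ) (A₀ := A₀) hℓ hj1 hjk hM ha hm x x') i) i'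
  rw [blk2_apply, Matrix.smul_apply, smul_eq_mul] at h
  exact h

variable (F κ A₀) in
/-- **The pieces `G^η_{(j)}(□, B̃₀)` of the decomposition (2.6) at the constant background**: `G^η_{(0)} = G^η_1(□,B̃₀) =
C^{(0),η}(□,B̃₀)`, `G^η_{(j)} = G^η_{j+1}(□,B̃₀) − G^η_j(□,B̃₀)` for `1 ≤ j ≤ k − 1` (= `a_j²(L^jη)^{−4}G^η_jQ_j^*C^{(j)}Q_jG^η_j` with
every factor covariant, [B4] (2.34)), and `0` for `j ≥ k` — verbatim the zero-field bookkeeping `B3Ineq210ZeroBox.piece` with the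
covariant scale operators `GfineA0`. [cite: Balaban1983Higgs3, (2.6) p.424] -/
def pieceA0 (ℓ k : ℕ) (M : Fin (d + 1) → ℕ) (j : ℕ) (a m2 : ℝ) :
    Matrix (↥(boxDom (Nf ℓ k M)) × ι) (↥(boxDom (Nf ℓ k M)) × ι) ℝ :=
  if j = 0 then GfineA0 F κ A₀ ℓ k M 1 a m2
  else if j + 1 ≤ k then GfineA0 F κ A₀ ℓ k M (j + 1) a m2 - GfineA0 F κ A₀ ℓ k M j a m2 else 0

/-- `G^η_{(0)}(□,B̃₀) = G^η_1(□,B̃₀)`. [cite: Balaban1983Higgs3, (2.6) p.424] -/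
theorem pieceA0_zero : pieceA0 F κ A₀ ℓ k M 0 a m2 = GfineA0 F κ A₀ ℓ k M 1 a m2 := by
  simp [pieceA0]

/-- `G^η_{(j)}(□,B̃₀) = G^η_{j+1}(□,B̃₀) − G^η_j(□,B̃₀)` for `1 ≤ j ≤ k − 1`. [cite: Balaban1983Higgs3, (2.6) p.424] -/
theorem pieceA0_of_pos (hj1 : 1 ≤ j) (hj : j + 1 ≤ k) :
    pieceA0 F κ A₀ ℓ k M j a m2 = GfineA0 F κ A₀ ℓ k M (j + 1) a m2 - GfineA0 F κ A₀ ℓ k M j a m2 := by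
  unfold pieceA0
  rw [if_neg (by omega), if_pos hj]

/-- no pieces beyond `j = k − 1`. [cite: Balaban1983Higgs3, (2.6) p.424] -/
theorem pieceA0_of_le (hj1 : 1 ≤ j) (hkj : k ≤ j) : pieceA0 F κ A₀ ℓ k M j a m2 = 0 := by
  unfold pieceA0
  rw [if_neg (by omega), if_neg (by omega)]

/-- **(2.6) AT THE CONSTANT BACKGROUND**: `Σ_{j=0}^{k−1} G^η_{(j)}(□, B̃₀) = G^η_k(□, B̃₀) = G_k(□, B̃₀)` — the covariant scale
pieces sum to [B4]'s propagator (1.6) `(−Δ^{η,N}_{B̃₀,□} + m² + a_kP_k(B̃₀))^{−1}` at the constant configuration (telescoping, no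
hypothesis). [cite: Balaban1983Higgs3, (2.6) p.424] -/
theorem sum_pieceA0 (hk : 1 ≤ k) :
    ∑ j ∈ Finset.range k, pieceA0 F κ A₀ ℓ k M j a m2 = GfineA0 F κ A₀ ℓ k M k a m2 := by
  have main : ∀ n, 1 ≤ n → n ≤ k → ∑ j ∈ Finset.range n, pieceA0 F κ A₀ ℓ k M j a m2 = GfineA0 F κ A₀ ℓ k M n a m2 := by
    intro n hn
    induction n, hn using Nat.le_induction with
    | base =>
      intro _
      rw [Finset.sum_range_one, pieceA0_zero]
    | succ n hn ih =>
      intro hnk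
      rw [Finset.sum_range_succ, ih (by omega), pieceA0_of_pos hn hnk, add_sub_cancel]
  exact main k hk le_rfl

/-- **«We get the same expressions as above with B̃₀ = 0 only» (p. 433) FOR THE PIECES OF (2.6)**: on the window (`k ≥ 1`),
`G^η_{(j)}(□, B̃₀) = 𝒢 (G^η_{(j)}(□, 0) ⊗ 1_N) 𝒢ᵀ` for EVERY `j`, with the zero-field pieces `B3Ineq210ZeroBox.piece` of this seat's
gen-4 file. [cite: Balaban1983Higgs3, p.433] -/
theorem pieceA0_eq (hℓ : 1 ≤ ℓ) (hk : 1 ≤ k) (hM : ∀ i, 1 ≤ M i) (ha : 0 < a) (hm : 0 ≤ m2) (j : ℕ) :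
    pieceA0 F κ A₀ ℓ k M j a m2
      = blockDiag (gA0 F κ A₀ ℓ k M) * (piece ℓ k M j a m2 ⊗ₖ (1 : Matrix ι ι ℝ)) * (blockDiag (gA0 F κ A₀ ℓ k M))ᵀ := by
  rcases Nat.eq_zero_or_pos j with rfl | hj1
  · rw [pieceA0_zero, piece_zero, GfineA0_eq hℓ le_rfl hk hM ha hm]
  · by_cases hj : j + 1 ≤ k
    · rw [pieceA0_of_pos hj1 hj, piece_of_pos hj1 hj, GfineA0_eq hℓ (by omega) hj hM ha hm,
        GfineA0_eq hℓ hj1 (by omega) hM ha hm, sub_kronecker_one, Matrix.mul_sub, Matrix.sub_mul]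
    · rw [pieceA0_of_le hj1 (by omega), piece_of_le hj1 (by omega), Matrix.zero_kronecker, Matrix.mul_zero,
        Matrix.zero_mul]

/-- **the blocks of the pieces**: `G^η_{(j)}(□,B̃₀;x,x′) = G^η_{(j)}(□,0;x,x′)·g(x)g(x′)ᵀ` — zero-field kernel times orthogonal transporter,
for every `j` (on the window, `k ≥ 1`). [cite: Balaban1983Higgs3, p.433] -/
theorem blk2_pieceA0 (hℓ : 1 ≤ ℓ) (hk : 1 ≤ k) (hM : ∀ i, 1 ≤ M i) (ha : 0 < a) (hm : 0 ≤ m2) (j : ℕ)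
    (x x' : ↥(boxDom (Nf ℓ k M))) :
    blk2 (pieceA0 F κ A₀ ℓ k M j a m2) x x' = piece ℓ k M j a m2 x x' • (gA0 F κ A₀ ℓ k M x * (gA0 F κ A₀ ℓ k M x')ᵀ) := by
  rw [pieceA0_eq hℓ hk hM ha hm, blk2_conj]

/-- the same, entrywise. [cite: Balaban1983Higgs3, p.433] -/
theorem pieceA0_apply (hℓ : 1 ≤ ℓ) (hk : 1 ≤ k) (hM : ∀ i, 1 ≤ M i) (ha : 0 < a) (hm : 0 ≤ m2) (j : ℕ)
    (x x' : ↥(boxDom (Nf ℓ k M))) (i i' : ι) :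
    pieceA0 F κ A₀ ℓ k M j a m2 (x, i) (x', i')
      = piece ℓ k M j a m2 x x' * (gA0 F κ A₀ ℓ k M x * (gA0 F κ A₀ ℓ k M x')ᵀ) i i' := by
  have h := congrFun (congrFun (blk2_pieceA0 (F := F) (κ := κ) (A₀ := A₀) hℓ hk hM ha hm j x x') i) i'
  rw [blk2_apply, Matrix.smul_apply, smul_eq_mul] at h
  exact h

/-- **entrywise domination by the zero-field pieces**: `|G^η_{(j)}(□,B̃₀)((x,i),(x′,i′))| ≤ |G^η_{(j)}(□,0;x,x′)|` — so every zero-field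
kernel bound of the lineage transfers verbatim (cf. `B4GaugeCovariance.abs_b4Green_constBond_le` for the one-scale operator).
[cite: Balaban1983Higgs3, (2.10) p.426] -/
theorem abs_pieceA0_le (hℓ : 1 ≤ ℓ) (hk : 1 ≤ k) (hM : ∀ i, 1 ≤ M i) (ha : 0 < a) (hm : 0 ≤ m2) (j : ℕ)
    (x x' : ↥(boxDom (Nf ℓ k M))) (i i' : ι) :
    |pieceA0 F κ A₀ ℓ k M j a m2 (x, i) (x', i')| ≤ |piece ℓ k M j a m2 x x'| := by
  rw [pieceA0_apply hℓ hk hM ha hm, abs_mul]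
  exact mul_le_of_le_one_right (abs_nonneg _)
    (abs_apply_le_one_of_orthogonal (orth_pair (isGauge_gA0 F κ A₀ ℓ k M) x x') i i')

end Pieces

/-! ## §4 Transporters and covariant differences at the constant background: `U(B̃₀(Γ_{x,x′})) = g(x)g(x′)ᵀ` for EVERY contour,
`D^η_{B̃₀,μ}` acting on the row variable of a kernel, and what both do to a gauge conjugate -/

section Transport

variable (F κ A₀)
variable {ℓ k : ℕ} {M : Fin (d + 1) → ℕ}

/-- the LINK VARIABLE / TRANSPORTER `U(κ·B̃₀(u,v)) = e^{qeη⟨B̃₀, v − u⟩}` of the constant field between two fine points: on a bond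
`⟨x, x+ηe_μ⟩` it is [B4] (1.2) `U(B̃₀,b)`, and for ANY pair it is the parallel transport `U(B̃₀(Γ_{u,v}))` along EVERY lattice
contour from `u` to `v` (`transport_eq_Ub`: a constant abelian configuration has zero curvature). [cite: Balaban1983Higgs3, (2.11) p.426] -/
def Ub (ℓ k : ℕ) (M : Fin (d + 1) → ℕ) (u v : ↥(boxDom (Nf ℓ k M))) : Matrix ι ι ℝ :=
  fieldLink F κ (constBond A₀ Subtype.val) u v

variable {F κ A₀}

/-- **the transporter is gauge-trivial**: `U(κB̃₀(u,v)) = g(u)g(v)ᵀ`, `g = U(κλ)` (`B4GaugeCovariance.fieldLink_constBond`).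
[cite: Balaban1983Higgs3, p.433] -/
theorem Ub_eq_pair (u v : ↥(boxDom (Nf ℓ k M))) :
    Ub F κ A₀ ℓ k M u v = gA0 F κ A₀ ℓ k M u * (gA0 F κ A₀ ℓ k M v)ᵀ := by
  have h := congrFun (congrFun (fieldLink_constBond F κ A₀ (Subtype.val : ↥(boxDom (Nf ℓ k M)) → _)) u) v
  rw [Ub, h, gaugeKer_apply, Matrix.mul_one]
  rfl

/-- **`U(B̃₀(Γ_{u,v}))` does not depend on the contour**: the transport of the constant configuration along ANY site list from `u`
is the transporter `Ub u (end point)` (`B4Lemma22HolderBox.transport_constBond`); in particular the print's «shortest contour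
Γ_{x₁,x₂}» of (1.32)/(2.11) needs no choice here. [cite: Balaban1983Higgs3, (1.32) p.420] -/
theorem transport_eq_Ub (u : ↥(boxDom (Nf ℓ k M))) (l : List ↥(boxDom (Nf ℓ k M))) :
    transport (fieldLink F κ (constBond A₀ Subtype.val)) u l = Ub F κ A₀ ℓ k M u (pathEnd u l) := by
  rw [transport_constBond, Ub_eq_pair]
  rfl

/-- the transporter is orthogonal. [cite: Balaban1983Higgs3, (1.32) p.420] -/
theorem Ub_orth (u v : ↥(boxDom (Nf ℓ k M))) : (Ub F κ A₀ ℓ k M u v)ᵀ * Ub F κ A₀ ℓ k M u v = 1 := by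
  rw [Ub_eq_pair]
  exact orth_pair (isGauge_gA0 F κ A₀ ℓ k M) u v

variable (F κ A₀) in
/-- `η·(D^η_{B̃₀,μ}K)(x, x′)` IN THE ROW VARIABLE along the bond `⟨x, xe⟩`, `xe = x + ηe_μ`, of an operator `K` on `ℝ^N`-valued
fields, as an `N × N` block: `U(B̃₀,⟨x,xe⟩)K(xe,x′) − K(x,x′)` ([B4] (1.3) «(D^η_Aφ)(b) = η^{−1}(U(A_b)φ(b₊) − φ(b₋))» applied to
the columns of `K`; the factor `η^{−1} = n` is kept outside, as in the zero-field carriers). [cite: Balaban1983Higgs3, (2.10) p.426] -/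
def covDiff (ℓ k : ℕ) (M : Fin (d + 1) → ℕ)
    (K : Matrix (↥(boxDom (Nf ℓ k M)) × ι) (↥(boxDom (Nf ℓ k M)) × ι) ℝ) (x xe x' : ↥(boxDom (Nf ℓ k M))) :
    Matrix ι ι ℝ :=
  Ub F κ A₀ ℓ k M x xe * blk2 K xe x' - blk2 K x x'

/-- DICTIONARY with the lineage's covariant derivative `B4Lemma21Region.covDeriv` ([B4] (1.3) as a matrix on `□ × ι`): for a bond
`⟨x, x+ηe_μ⟩ ⊂ □`, the `(x,x′)` block of `D^η_{B̃₀,μ}K` (operator product) is `n·covDiff K x (x+e_μ) x′`.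
[cite: Balaban1983Higgs3, (2.10) p.426] -/
theorem blk2_covDeriv_mul_of_mem (K : Matrix (↥(boxDom (Nf ℓ k M)) × ι) (↥(boxDom (Nf ℓ k M)) × ι) ℝ)
    {μ : Fin (d + 1)} {x : ↥(boxDom (Nf ℓ k M))} (h : x.1 + B4Lower18Regular.e1 μ ∈ boxDom (Nf ℓ k M))
    (x' : ↥(boxDom (Nf ℓ k M))) :
    blk2 (B4Lemma21Region.covDeriv ((ℓ + 1) ^ k) (boxDom (Nf ℓ k M)) (fieldLink F κ (constBond A₀ Subtype.val)) μ * K) x x'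
      = ((((ℓ + 1) ^ k : ℕ) : ℝ)) • covDiff F κ A₀ ℓ k M K x ⟨x.1 + B4Lower18Regular.e1 μ, h⟩ x' := by
  ext i i'
  have hcol : ∀ p : ↥(boxDom (Nf ℓ k M)) × ι,
      (B4Lemma21Region.covDeriv ((ℓ + 1) ^ k) (boxDom (Nf ℓ k M)) (fieldLink F κ (constBond A₀ Subtype.val)) μ * K) p (x', i')
        = (B4Lemma21Region.covDeriv ((ℓ + 1) ^ k) (boxDom (Nf ℓ k M)) (fieldLink F κ (constBond A₀ Subtype.val)) μ
            *ᵥ fun q => K q (x', i')) p := fun p => rfl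
  rw [blk2_apply, hcol, show (B4Lemma21Region.covDeriv ((ℓ + 1) ^ k) (boxDom (Nf ℓ k M))
      (fieldLink F κ (constBond A₀ Subtype.val)) μ *ᵥ fun q => K q (x', i')) (x, i)
      = fld (B4Lemma21Region.covDeriv ((ℓ + 1) ^ k) (boxDom (Nf ℓ k M))
          (fieldLink F κ (constBond A₀ Subtype.val)) μ *ᵥ fun q => K q (x', i')) x i from rfl,
    B4Lemma21Region.fld_covDeriv_mulVec_of_mem _ _ _ h]
  simp only [Pi.smul_apply, Pi.sub_apply, Matrix.smul_apply, Matrix.sub_apply, covDiff, Ub, blk2, Matrix.mul_apply,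
    Matrix.of_apply, Matrix.mulVec, dotProduct, fld_apply, Nat.cast_pow, Nat.cast_add, Nat.cast_one, smul_eq_mul]

/-- … and no bond, no derivative (Neumann): for `x + ηe_μ ∉ □` the block vanishes. [cite: Balaban1983Higgs3, (2.10) p.426] -/
theorem blk2_covDeriv_mul_of_not_mem (K : Matrix (↥(boxDom (Nf ℓ k M)) × ι) (↥(boxDom (Nf ℓ k M)) × ι) ℝ)
    {μ : Fin (d + 1)} {x : ↥(boxDom (Nf ℓ k M))} (h : x.1 + B4Lower18Regular.e1 μ ∉ boxDom (Nf ℓ k M))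
    (x' : ↥(boxDom (Nf ℓ k M))) :
    blk2 (B4Lemma21Region.covDeriv ((ℓ + 1) ^ k) (boxDom (Nf ℓ k M)) (fieldLink F κ (constBond A₀ Subtype.val)) μ * K) x x'
      = 0 := by
  ext i i'
  have hcol : ∀ p : ↥(boxDom (Nf ℓ k M)) × ι,
      (B4Lemma21Region.covDeriv ((ℓ + 1) ^ k) (boxDom (Nf ℓ k M)) (fieldLink F κ (constBond A₀ Subtype.val)) μ * K) p (x', i')
        = (B4Lemma21Region.covDeriv ((ℓ + 1) ^ k) (boxDom (Nf ℓ k M)) (fieldLink F κ (constBond A₀ Subtype.val)) μ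
            *ᵥ fun q => K q (x', i')) p := fun p => rfl
  rw [blk2_apply, hcol, show (B4Lemma21Region.covDeriv ((ℓ + 1) ^ k) (boxDom (Nf ℓ k M))
      (fieldLink F κ (constBond A₀ Subtype.val)) μ *ᵥ fun q => K q (x', i')) (x, i)
      = fld (B4Lemma21Region.covDeriv ((ℓ + 1) ^ k) (boxDom (Nf ℓ k M))
          (fieldLink F κ (constBond A₀ Subtype.val)) μ *ᵥ fun q => K q (x', i')) x i from rfl,
    B4Lemma21Region.fld_covDeriv_mulVec_of_not_mem _ _ _ h]
  rfl

/-- kernel: **the covariant difference of a gauge conjugate** is the plain difference of the one-component kernel times the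
transporter: `U(B̃₀,⟨x,xe⟩)·(S(xe,x′)g(xe)g(x′)ᵀ) − S(x,x′)g(x)g(x′)ᵀ = (S(xe,x′) − S(x,x′))·g(x)g(x′)ᵀ` — p. 433 «the same
expressions as above with B̃₀ = 0 only» for a covariantly differentiated propagator. [cite: Balaban1983Higgs3, p.433] -/
theorem covDiff_conj (S : Matrix ↥(boxDom (Nf ℓ k M)) ↥(boxDom (Nf ℓ k M)) ℝ) (x xe x' : ↥(boxDom (Nf ℓ k M))) :
    covDiff F κ A₀ ℓ k M
        (blockDiag (gA0 F κ A₀ ℓ k M) * (S ⊗ₖ (1 : Matrix ι ι ℝ)) * (blockDiag (gA0 F κ A₀ ℓ k M))ᵀ) x xe x'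
      = (S xe x' - S x x') • (gA0 F κ A₀ ℓ k M x * (gA0 F κ A₀ ℓ k M x')ᵀ) := by
  rw [covDiff, blk2_conj, blk2_conj, Ub_eq_pair, Matrix.mul_smul, pair_mul_pair (isGauge_gA0 F κ A₀ ℓ k M), sub_smul]

/-- kernel: **the transported difference of (1.32)/(2.11) of a gauge conjugate**: `U(B̃₀(Γ_{x₁,x₂}))(ηD K)(x₂,x) − (ηD K)(x₁,x) =
((S(xe₂,x) − S(x₂,x)) − (S(xe₁,x) − S(x₁,x)))·g(x₁)g(x)ᵀ` — p. 433/434: the transporter `U(B̃₀(Γ_{x₁,x₂}))` of (1.32)/(2.11)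
compensates the gauge factors exactly («these norms are equal to the norms defined by (1.32) with B̃ = B̃₀»).
[cite: Balaban1983Higgs3, p.433] -/
theorem holderBlock_conj (S : Matrix ↥(boxDom (Nf ℓ k M)) ↥(boxDom (Nf ℓ k M)) ℝ)
    (x₁ xe₁ x₂ xe₂ x : ↥(boxDom (Nf ℓ k M))) :
    Ub F κ A₀ ℓ k M x₁ x₂ * covDiff F κ A₀ ℓ k M
          (blockDiag (gA0 F κ A₀ ℓ k M) * (S ⊗ₖ (1 : Matrix ι ι ℝ)) * (blockDiag (gA0 F κ A₀ ℓ k M))ᵀ) x₂ xe₂ x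
        - covDiff F κ A₀ ℓ k M
          (blockDiag (gA0 F κ A₀ ℓ k M) * (S ⊗ₖ (1 : Matrix ι ι ℝ)) * (blockDiag (gA0 F κ A₀ ℓ k M))ᵀ) x₁ xe₁ x
      = ((S xe₂ x - S x₂ x) - (S xe₁ x - S x₁ x)) • (gA0 F κ A₀ ℓ k M x₁ * (gA0 F κ A₀ ℓ k M x)ᵀ) := by
  rw [covDiff_conj, covDiff_conj, Ub_eq_pair, Matrix.mul_smul, pair_mul_pair (isGauge_gA0 F κ A₀ ℓ k M), ← sub_smul]

end Transport

end

end Literature.MathematicalPhysics.QuantumFieldTheory.Balaban1983to89.B3Eq26ConstBox
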